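import Literature.Computability.AlgebraicComplexity.GrenetEquivariant
import Literature.Computability.AlgebraicComplexity.DetReprEquivalent
import Literature.Computability.AlgebraicComplexity.LandsbergRessayre
import Literature.Computability.AlgebraicComplexity.LRPencilOfMatrix
import Literature.Computability.AlgebraicComplexity.GrenetWeightedPaths
import Literature.Computability.AlgebraicComplexity.GrenetPathPotentials
import Literature.Computability.AlgebraicComplexity.WeightedPermanentRigidity

/-! # Crux `UniqStep` (stmt-ValiantsHypothesis-17834), line `Sketch` — stub `stub_gradedRigidity`:
# rigidity of graded generalised Grenet matrices

WHAT. A GENERALISED GRENET MATRIX `G(a, e)` is Grenet's `(2^N - 1) × (2^N - 1)` matrix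
(`Grenet.repr`: the `(univ, ∅)` minor of `1 - adj` for the branching program on the subsets of
`Fin N`, reindexed along `e`, times the sign `(-1)^(e univ + e ∅)`) in which the arc
`S → insert k S` carries an arbitrary linear form `∑_c a S k c · x_{k,c}` in the row-`k` variables
instead of `x_{k,|S|}`.  `stub_gradedRigidity`: if the levels are PROPORTIONAL, `a S k c = ρ S k · α |S| c`
(`k ∉ S`), and `det G(a, e) = per_N`, then `G(a, e)` is `DetReprEquivalent (permSymmetrySubst ℂ N)`
to `Grenet.repr ℂ N e` — in fact `G(a, e) = P · Grenet.repr(γ · x) · Q` with `P, Q` constant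
invertible DIAGONAL matrices and `γ = 1 ⊗ P_{π⁻¹}` a right PERMUTATION substitution
`x_{k,c} ↦ x_{k,π c}` (`rightMonomialSubst ⊆ permSymmetrySubst`).

Proof. (1) `det G(a, e) = ∑_σ ∏ₜ ℓ(σ({i<t}), σ t)` is the sum of the path products of the
branching program (`Grenet.det_arc_repr`, `GrenetWeightedPaths.lean`); with proportional levels
this is the weighted permanent `∑_σ w(σ) ∏ₜ (∑_c α t c x_{σ t,c})`, `w(σ) = ∏ₜ ρ(σ({i<t}), σ t)`.
(2) `= per_N` forces `α t c = d t · [c = π t]` (monomial) and `w(σ) · ∏ d = 1` for all `σ`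
(`exists_monomial_of_weighted_permanent_eq_perPoly`, `WeightedPermanentRigidity.lean`: one-sided
Marcus–May).  (3) The scalar arc weights `ρ S k · d |S|` then have all full path products `1`, so
they are a coboundary `μ(insert k S)/μ(S)` (`Grenet.exists_potential_of_prod_prefix_eq_one`,
`GrenetPathPotentials.lean`).  (4) Hence `1 - A' = diag(μ)⁻¹ · (1 - adj)(γ · x) · diag(μ)`
entrywise, and minors of diagonal conjugates are diagonal conjugates of minors
(`Grenet.submatrix_diagonal_mul_mul_diagonal`), exactly as in `Grenet.linSubstEntries_torus_repr`.

WHY. Last step of `UniqStep_of` (line `Sketch`): the bet makes an optimal projection of `per_N`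
left-monomially symmetric, S3 gauges it to some `G(a, e)`, S4 makes the levels proportional, and
this stub identifies the result with Grenet's matrix up to gauge and a right monomial substitution.

SOURCE. Folklore / this line (rigidity of the equality case of Landsberg–Ressayre 2017, Thm. 2.8,
§6; key `LandsbergRessayre2017`); M. Marcus, F. C. May, *The permanent function*, Canad. J. Math.
14 (1962) (linear preservers of the permanent — only the elementary one-sided case is used, proved
in `WeightedPermanentRigidity.lean`); B. Grenet (2011), Thm. 1 (key `Grenet2011`).
-/

-- D-0017 layout: Sub = Summit for this single-conjunct summit, so the namespace repeats a component.
set_option linter.dupNamespace false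

namespace Summit.ValiantsHypothesis.ValiantsHypothesis.Theorems.ProjectionStabilityUniqStep

open MvPolynomial
open scoped BigOperators Matrix Kronecker
open Literature.Computability.AlgebraicComplexity

noncomputable section

/-! ### The right permutation substitution `x_{k,c} ↦ x_{k, θ⁻¹ c}` -/

/-- The substitution `1 ⊗ P_θ` (right multiplication of the variable matrix by a permutation matrix)
sends the variable `x_{k,c}` to `x_{k, θ⁻¹ c}` (convention of `linSubst`: `X i ↦ ∑ j, A j i • X j`,
and `P_θ j i = [θ j = i]`). [folklore] -/
theorem linSubst_one_kronecker_permMatrix_X {N : ℕ} (θ : Equiv.Perm (Fin N)) (k c : Fin N) :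
    linSubst (Fin N × Fin N) ℂ ((1 : Matrix (Fin N) (Fin N) ℂ) ⊗ₖ (θ.permMatrix ℂ))
      (X (k, c)) = X (k, θ.symm c) := by
  rw [linSubst_X, Fintype.sum_prod_type]
  simp only [Matrix.kronecker_apply, Matrix.one_apply, Equiv.Perm.permMatrix, PEquiv.toMatrix_apply,
    Equiv.toPEquiv_apply, Option.mem_def, Option.some.injEq, ite_mul, one_mul, zero_mul, ite_smul,
    one_smul, zero_smul, Equiv.apply_eq_iff_eq_symm_apply, Finset.sum_ite_irrel,
    Finset.sum_const_zero, Finset.sum_ite_eq', Finset.mem_univ, if_true]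

/-- `1 ⊗ P_θ` is a right monomial symmetry, hence lies in `permSymmetrySubst`
(`rightMonomialSubst ≤ permSymmetrySubst`). [cite: LandsbergRessayre2017, §2.1] -/
theorem one_kronecker_permUnit_mem {N : ℕ} (θ : Equiv.Perm (Fin N)) :
    Matrix.GeneralLinearGroup.kronecker (1 : GL (Fin N) ℂ) (LRPencil.permUnit ℂ θ) ∈
      permSymmetrySubst ℂ N := by
  have hright : Matrix.GeneralLinearGroup.kronecker (1 : GL (Fin N) ℂ) (LRPencil.permUnit ℂ θ) ∈
      rightMonomialSubst ℂ N :=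
    Subgroup.subset_closure ⟨LRPencil.permUnit ℂ θ, LRPencil.permUnit_mem ℂ θ, rfl⟩
  exact Subgroup.subset_closure (Or.inl (Or.inr hright))

/-! ### Path products of a graded generalised Grenet matrix -/

/-- With proportional levels `a S k c = ρ S k · α |S| c` (`k ∉ S`), the path product of an ordering
`σ` factors as `w(σ) • ∏ₜ (∑_c α t c • x_{σ t, c})` with the scalar path weight
`w(σ) = ∏ₜ ρ (σ({i<t})) (σ t)` (`σ t ∉ σ({i<t})`, `|σ({i<t})| = t`). [folklore] -/
theorem prod_levelForms_eq_smul {N : ℕ} {a : Finset (Fin N) → Fin N → Fin N → ℂ}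
    {ρ : Finset (Fin N) → Fin N → ℂ} {α : ℕ → Fin N → ℂ}
    (hprop : ∀ (S : Finset (Fin N)) (k c : Fin N), k ∉ S → a S k c = ρ S k * α S.card c)
    (σ : Equiv.Perm (Fin N)) :
    ∏ t : Fin N, ∑ c, a ((Finset.univ.filter fun i : Fin N => (i : ℕ) < (t : ℕ)).image σ) (σ t) c •
        (X (σ t, c) : MvPolynomial (Fin N × Fin N) ℂ) =
      (∏ t : Fin N, ρ ((Finset.univ.filter fun i : Fin N => (i : ℕ) < (t : ℕ)).image σ) (σ t)) •
        ∏ t : Fin N, ∑ c, α t c • (X (σ t, c) : MvPolynomial (Fin N × Fin N) ℂ) := by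
  rw [← Finset.prod_smul]
  refine Finset.prod_congr rfl fun t _ => ?_
  rw [Finset.smul_sum]
  refine Finset.sum_congr rfl fun c _ => ?_
  rw [hprop _ _ _ (Grenet.not_mem_prefix_image_self σ t), Grenet.card_prefix_image σ t.isLt.le,
    mul_smul]

/-! ### The registered stub -/

/-- **STUB S5** of line `Sketch` of crux `UniqStep` — rigidity of graded generalised Grenet
matrices: if `G(a, e)` (`N ≥ 3`, size `2^N - 1`) has proportional levels
`a S k c = ρ S k · α |S| c` (`k ∉ S`) and `det G(a, e) = per_N`, then it is
`DetReprEquivalent (permSymmetrySubst ℂ N)` to Grenet's matrix `Grenet.repr ℂ N e`: the weighted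
permanent identity forces `α` monomial and all path weights equal (one-sided Marcus–May), the scalar
arc weights are then a coboundary (potential `μ`), and
`G(a, e) = diag(μ)⁻¹ · Grenet.repr(x · P_π) · diag(μ)` on the surviving rows and columns.
[folklore] -/
theorem stub_gradedRigidity :
    ∀ (N m : ℕ), 3 ≤ N → m + 1 = 2 ^ N →
      ∀ (e : Finset (Fin N) ≃ Fin (m + 1)) (a : Finset (Fin N) → Fin N → Fin N → ℂ)
        (ρ : Finset (Fin N) → Fin N → ℂ) (α : ℕ → Fin N → ℂ),
        (∀ (S : Finset (Fin N)) (k c : Fin N), k ∉ S → a S k c = ρ S k * α S.card c) →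
        ((-1 : MvPolynomial (Fin N × Fin N) ℂ) ^ ((e Finset.univ : ℕ) + (e ∅ : ℕ)) •
            (((1 - Matrix.of fun S T : Finset (Fin N) =>
                ∑ k : Fin N, if k ∉ S ∧ T = insert k S
                  then ∑ c : Fin N, a S k c • (X (k, c) : MvPolynomial (Fin N × Fin N) ℂ)
                  else 0).submatrix e.symm e.symm).submatrix
              (Fin.succAbove (e Finset.univ)) (Fin.succAbove (e ∅)))).det = perPoly (Fin N) ℂ →
        DetReprEquivalent (permSymmetrySubst ℂ N)
          ((-1 : MvPolynomial (Fin N × Fin N) ℂ) ^ ((e Finset.univ : ℕ) + (e ∅ : ℕ)) •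
            (((1 - Matrix.of fun S T : Finset (Fin N) =>
                ∑ k : Fin N, if k ∉ S ∧ T = insert k S
                  then ∑ c : Fin N, a S k c • (X (k, c) : MvPolynomial (Fin N × Fin N) ℂ)
                  else 0).submatrix e.symm e.symm).submatrix
              (Fin.succAbove (e Finset.univ)) (Fin.succAbove (e ∅))))
          (Grenet.repr ℂ N e) := by
  intro N m hN hm e a ρ α hprop hdet
  have hN0 : N ≠ 0 := by omega
  set A' : Matrix (Finset (Fin N)) (Finset (Fin N)) (MvPolynomial (Fin N × Fin N) ℂ) :=
    Matrix.of fun S T : Finset (Fin N) => ∑ k : Fin N, if k ∉ S ∧ T = insert k S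
      then ∑ c : Fin N, a S k c • (X (k, c) : MvPolynomial (Fin N × Fin N) ℂ) else 0 with hA'_def
  have hA' : ∀ S T, A' S T = ∑ k, if k ∉ S ∧ T = insert k S
      then (fun S k => ∑ c : Fin N, a S k c • (X (k, c) : MvPolynomial (Fin N × Fin N) ℂ)) S k
      else 0 := fun S T => rfl
  -- (1) the determinant is the weighted permanent
  rw [Grenet.det_arc_repr hN0 hm.symm e _ hA'] at hdet
  simp only [prod_levelForms_eq_smul hprop] at hdet
  -- (2) rigidity of the weighted permanent
  obtain ⟨π, d, hα, hw⟩ :=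
    exists_monomial_of_weighted_permanent_eq_perPoly _ (fun t c => α t c) hdet
  -- (3) potential for the scalar arc weights `ρ S k * d |S|`
  set dN : ℕ → ℂ := fun j => if h : j < N then d ⟨j, h⟩ else 1 with hdN_def
  have hdN : ∀ t : Fin N, dN t = d t := fun t => by simp [hdN_def, t.isLt]
  obtain ⟨μ, hμ0, hμ⟩ := Grenet.exists_potential_of_prod_prefix_eq_one
    (fun S k => ρ S k * dN S.card) (fun σ => by
      simp only [Finset.prod_mul_distrib, Grenet.card_prefix_image σ (Fin.isLt _).le, hdN]
      exact hw σ)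
  have hα' : ∀ t c : Fin N, α (t : ℕ) c = if c = π t then d t else 0 := hα
  -- (4) assembly: the substitution `x_{k,c} ↦ x_{k,π c}` and the diagonal gauge `μ`
  set θ : Equiv.Perm (Fin N) := π.symm with hθ_def
  set γ : GL (Fin N × Fin N) ℂ :=
    Matrix.GeneralLinearGroup.kronecker (1 : GL (Fin N) ℂ) (LRPencil.permUnit ℂ θ) with hγ_def
  have hγval : (γ : Matrix (Fin N × Fin N) (Fin N × Fin N) ℂ) =
      (1 : Matrix (Fin N) (Fin N) ℂ) ⊗ₖ (θ.permMatrix ℂ) := rfl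
  set f := linSubst (Fin N × Fin N) ℂ (γ : Matrix (Fin N × Fin N) (Fin N × Fin N) ℂ) with hf_def
  have hfX : ∀ k c : Fin N, f (X (k, c)) = X (k, π c) := fun k c => by
    rw [hf_def, hγval, linSubst_one_kronecker_permMatrix_X, hθ_def, Equiv.symm_symm]
  have hM0 : ∀ S T, A' S T = C (μ S)⁻¹ * f (Grenet.adj ℂ N S T) * C (μ T) := by
    intro S T
    rw [hA', Grenet.adj_apply, map_sum, Finset.mul_sum, Finset.sum_mul]
    refine Finset.sum_congr rfl fun k _ => ?_
    by_cases hc : k ∉ S ∧ T = insert k S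
    · rw [if_pos hc, if_pos hc]
      obtain ⟨hk, rfl⟩ := hc
      have hlt : S.card < N := Grenet.card_lt_of_notMem hk
      have hwt : Grenet.wt ℂ N k S.card = X (k, ⟨S.card, hlt⟩) := by simp [Grenet.wt, hlt]
      have hd : dN S.card = d ⟨S.card, hlt⟩ := hdN ⟨S.card, hlt⟩
      have h1 : (C (μ S)⁻¹ : MvPolynomial (Fin N × Fin N) ℂ) * C (μ S) = 1 := by
        rw [← map_mul, inv_mul_cancel₀ (hμ0 S), map_one]
      rw [hwt, hfX, hμ S k hk]
      dsimp only
      rw [hd, Finset.sum_eq_single (π ⟨S.card, hlt⟩) (fun c _ hc => by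
          rw [hprop S k c hk, hα' ⟨S.card, hlt⟩ c, if_neg hc, mul_zero, zero_smul])
        (fun h => absurd (Finset.mem_univ _) h), hprop S k _ hk, hα' ⟨S.card, hlt⟩, if_pos rfl,
        smul_eq_C_mul, show C (μ S * (ρ S k * d ⟨S.card, hlt⟩)) =
          C (μ S) * C (ρ S k * d ⟨S.card, hlt⟩) from map_mul C _ _]
      linear_combination (-(C (ρ S k * d ⟨S.card, hlt⟩) *
        (X (k, π ⟨S.card, hlt⟩) : MvPolynomial (Fin N × Fin N) ℂ))) * h1
    · rw [if_neg hc, if_neg hc, map_zero, mul_zero, zero_mul]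
  have hM1 : (1 - A') = Matrix.diagonal (fun S => C (μ S)⁻¹) * (1 - Grenet.adj ℂ N).map f *
      Matrix.diagonal (fun T => C (μ T)) := by
    refine Matrix.ext fun S T => ?_
    rw [Matrix.mul_diagonal, Matrix.diagonal_mul, Matrix.map_apply, Matrix.sub_apply,
      Matrix.sub_apply, map_sub, hM0 S T, Matrix.one_apply]
    by_cases hST : S = T
    · subst hST
      have h1 : (C (μ S)⁻¹ : MvPolynomial (Fin N × Fin N) ℂ) * C (μ S) = 1 := by
        rw [← map_mul, inv_mul_cancel₀ (hμ0 S), map_one]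
      rw [if_pos rfl, map_one]
      linear_combination -h1
    · rw [if_neg hST, map_zero]
      ring
  have hsign : f ((-1 : MvPolynomial (Fin N × Fin N) ℂ) ^ ((e Finset.univ : ℕ) + (e ∅ : ℕ))) =
      (-1 : MvPolynomial (Fin N × Fin N) ℂ) ^ ((e Finset.univ : ℕ) + (e ∅ : ℕ)) := by
    rw [map_pow, map_neg, map_one]
  have hrepr : Matrix.linSubstEntries γ (Grenet.repr ℂ N e) =
      (-1 : MvPolynomial (Fin N × Fin N) ℂ) ^ ((e Finset.univ : ℕ) + (e ∅ : ℕ)) •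
        (((1 - Grenet.adj ℂ N).map f).submatrix e.symm e.symm).submatrix
          (Fin.succAbove (e Finset.univ)) (Fin.succAbove (e ∅)) := by
    unfold Matrix.linSubstEntries Grenet.repr
    rw [← hf_def, Matrix.map_smul' _ _ _ (map_mul f), hsign, ← Matrix.submatrix_map,
      ← Matrix.submatrix_map]
  have hP : ∀ i : Fin m, (μ (e.symm (Fin.succAbove (e Finset.univ) i)))⁻¹ ≠ 0 :=
    fun i => inv_ne_zero (hμ0 _)
  have hQ : ∀ j : Fin m, μ (e.symm (Fin.succAbove (e ∅) j)) ≠ 0 := fun j => hμ0 _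
  refine DetReprEquivalent.symm
    ⟨Grenet.diagUnit _ hP, Grenet.diagUnit _ hQ, γ, one_kronecker_permUnit_mem θ, Or.inl ?_⟩
  rw [hrepr, Grenet.val_diagUnit, Grenet.val_diagUnit, Matrix.diagonal_map (map_zero C),
    Matrix.diagonal_map (map_zero C), hM1, Grenet.submatrix_diagonal_mul_mul_diagonal,
    Grenet.submatrix_diagonal_mul_mul_diagonal, Matrix.mul_smul, Matrix.smul_mul]
  rfl

end

end Summit.ValiantsHypothesis.ValiantsHypothesis.Theorems.ProjectionStabilityUniqStep
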